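import Mathlib
import Summits.MatrixMultiplication.MatrixMultiplication.Theorems.GraphEquationsInitialForms
import Literature.RingTheory.MvPolynomial.SystemOfParameters
import Literature.Algebra.Polynomial.JacobianCriterion
import Literature.LinearAlgebra.Matrix.RankMinors

/-!
# An isolated fibre of a family of FORMS forces full generic Jacobian rank (`GraphEquations`, kernel M11)

Decomp-mm node «GraphEquations» (lens 5); attacked leaf `MultiplicityReduction` (`H_mult`);
registered line «initform» (`Cruxes/MultiplicityReduction/Lines/initform.lean`), stub
`stub_isolatedForcesRank` in its HOMOGENEOUS form (line card, sharpening s3: `stub_2′`) — which is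
all the line consumes, since pure initial forms are weighted-homogeneous components, hence forms
(kernel M12).  Target of the node, VERBATIM: `_root_.MatrixMultiplication`.

THEOREM (characteristic `0`; here over `ℂ`).  Let `P_1, …, P_T ∈ ℂ[x_σ]` (`σ` finite) be
HOMOGENEOUS and suppose the fibre of `P = (P_o)_o` through the origin is the origin alone,
`{x | ∀ o, P_o(x) = P_o(0)} = {0}`.  Then at some point `γ` the Jacobian matrix `(∂P_o/∂x_j)(γ)`
has rank `|σ|`.

Proof — every input is a tree theorem.  Centre the forms (`Q_o = P_o − P_o(0)`: forms of degree
`0` become `0`, the others are unchanged; `isHomogeneous_sub_C_coeff_zero`), so that `V(Q) = {0}`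
set-theoretically.  By Neusel–Smith Prop. A.3.6 / the projective Nullstellensatz
(`Literature.RingTheory.MvPolynomial.SystemOfParameters.moduleFinite_adjoin_of_forall_aeval_eq_zero`)
`ℂ[x_σ]` is a finite `ℂ[Q]`-module, hence algebraic over `ℂ[Q]`, so `{Q_o}` contains a
transcendence basis of `ℂ[x_σ]/ℂ` (`exists_isTranscendenceBasis_subset`), of size `trdeg = |σ|`
(`MvPolynomial.trdeg_of_isDomain`): `|σ|` algebraically independent members `Q_{rows k}`.  By the
Jacobian criterion (Humphreys § 3.10,
`Literature.Algebra.Polynomial.JacobianCriterion.det_jacobianMatrix_ne_zero_of_algebraicIndependent`)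
their Jacobian determinant is a non-zero polynomial, so it does not vanish at some `γ`
(`MvPolynomial.funext`, `ℂ` infinite), and a non-zero maximal minor gives rank `|σ|`
(`Literature.LinearAlgebra.Matrix.card_le_rank_of_det_submatrix_ne_zero`, `Matrix.rank_le_card_width`).

* `isHomogeneous_sub_C_coeff_zero` — centring a form gives a form of positive degree;
* `exists_jacobian_rank_eq_card_of_isHomogeneous` — the theorem over any finite variable type;
* `isolatedForcesRank_of_isHomogeneous` — the `gradMatrix` form over `Fin n × Fin n`, rank `n * n`
  (`stub_isolatedForcesRank` of line «initform» restricted to forms).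

No `sorry`, no definitions.  Sources: [Humphreys1990, § 3.10 Proposition]; [NeuselSmith2010,
Appendix A.3, Prop. A.3.6]; [BurgisserClausenShokrollahi1997, Problem 16.3] (the node).
-/

set_option linter.dupNamespace false

noncomputable section

open scoped BigOperators

namespace Summit.MatrixMultiplication.MatrixMultiplication.Theorems.GraphEquations

open MvPolynomial
open Literature.Algebra.Polynomial.JacobianCriterion

/-! ## Centring a form -/

/-- `p − p(0)` is a form of degree `max d 1` if `p` is a form of degree `d` (for `d = 0` it is `0`,
for `d ≥ 1` it is `p` itself). -/
theorem isHomogeneous_sub_C_coeff_zero {σ : Type*} {p : MvPolynomial σ ℂ} {d : ℕ}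
    (hp : p.IsHomogeneous d) : (p - C (coeff 0 p)).IsHomogeneous (max d 1) := by
  rcases Nat.eq_zero_or_pos d with rfl | hd
  · -- degree `0`: `p` is a constant
    have h0 : p.totalDegree = 0 := by
      by_cases hp0 : p = 0
      · rw [hp0, totalDegree_zero]
      · exact hp.totalDegree hp0
    rw [totalDegree_eq_zero_iff_eq_C] at h0
    rw [← h0, sub_self]
    exact isHomogeneous_zero _ _ _
  · -- positive degree: `p(0) = 0`
    have hc : coeff 0 p = 0 := hp.coeff_eq_zero (by rw [map_zero]; omega)
    have hd1 : 1 ≤ d := hd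
    rw [hc, C_0, sub_zero, max_eq_left hd1]
    exact hp

/-! ## The theorem over a finite variable type -/

/-- **An isolated fibre of a family of forms forces full generic Jacobian rank.**  If
`P_o ∈ ℂ[x_σ]` (`o < T`, `σ` finite) are homogeneous and `{x | ∀ o, P_o(x) = P_o(0)} = {0}`, then
`rank (∂P_o/∂x_j)(γ) = |σ|` at some `γ`.  (Finite ⇒ algebraic over `ℂ[P]`, a transcendence basis
among the `P_o`, the Jacobian criterion, a point off the hypersurface `J = 0`.) -/
theorem exists_jacobian_rank_eq_card_of_isHomogeneous {σ : Type} [Fintype σ] {T : ℕ}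
    (P : Fin T → MvPolynomial σ ℂ) (d : Fin T → ℕ) (hP : ∀ o, (P o).IsHomogeneous (d o))
    (hiso : ∀ x : σ → ℂ, (∀ o, eval x (P o) = eval 0 (P o)) → x = 0) :
    ∃ γ : σ → ℂ,
      (Matrix.of fun o j => eval γ (pderiv j (P o)) : Matrix (Fin T) σ ℂ).rank = Fintype.card σ := by
  classical
  -- Step 1: centre the forms
  obtain ⟨Q, hQP⟩ : ∃ Q : Fin T → MvPolynomial σ ℂ, ∀ o, Q o = P o - C (coeff 0 (P o)) :=
    ⟨_, fun o => rfl⟩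
  have hQh : ∀ o, (Q o).IsHomogeneous (max (d o) 1) := fun o => by
    rw [hQP o]
    exact isHomogeneous_sub_C_coeff_zero (hP o)
  have hd1 : ∀ o, max (d o) 1 ≠ 0 := fun o => by omega
  have hpd : ∀ o j, pderiv j (Q o) = pderiv j (P o) := fun o j => by
    rw [hQP o, map_sub, pderiv_C, sub_zero]
  -- the fibre of `Q` through `0` is `{0}`
  have hz : ∀ x : σ → ℂ, (∀ o, aeval x (Q o) = 0) → x = 0 := by
    intro x hx
    refine hiso x fun o => ?_
    have h : eval x (Q o) = 0 := hx o
    rw [hQP o, map_sub, eval_C, sub_eq_zero] at h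
    rw [h, MvPolynomial.eval_zero, constantCoeff_eq]
  -- Step 2: `ℂ[x_σ]` is a finite `ℂ[Q]`-module (Neusel–Smith A.3.6), hence algebraic over `ℂ[Q]`
  haveI hfin : Module.Finite (Algebra.adjoin ℂ (Set.range Q)) (MvPolynomial σ ℂ) :=
    Literature.RingTheory.MvPolynomial.SystemOfParameters.moduleFinite_adjoin_of_forall_aeval_eq_zero
      Q hQh hd1 (L := ℂ) hz
  haveI : Algebra.IsAlgebraic (Algebra.adjoin ℂ (Set.range Q)) (MvPolynomial σ ℂ) :=
    Algebra.IsIntegral.isAlgebraic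
  -- Step 3: a transcendence basis of `ℂ[x_σ]/ℂ` inside `{Q_o}`, necessarily of size `|σ|`
  obtain ⟨t, hts, ht⟩ := exists_isTranscendenceBasis_subset (R := ℂ) (Set.range Q)
  have hcard : Cardinal.mk σ = Cardinal.mk t := by
    rw [ht.cardinalMk_eq_trdeg, MvPolynomial.trdeg_of_isDomain, Cardinal.lift_id]
  obtain ⟨e⟩ := Cardinal.eq.mp hcard
  have hmem : ∀ k : σ, ∃ o : Fin T, Q o = (e k : MvPolynomial σ ℂ) := fun k => hts (e k).2
  choose rows hrows using hmem
  -- the square family `f_k = Q_{rows k}` is algebraically independent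
  obtain ⟨f, hfQ⟩ : ∃ f : σ → MvPolynomial σ ℂ, ∀ k, f k = Q (rows k) := ⟨_, fun k => rfl⟩
  have hfi : AlgebraicIndependent ℂ f := by
    have h := ht.1.comp e e.injective
    have hfe : f = ((↑) : t → MvPolynomial σ ℂ) ∘ e := funext fun k => by
      rw [hfQ k, hrows k, Function.comp_apply]
    rw [hfe]
    exact h
  -- Step 4: the Jacobian criterion (Humphreys § 3.10): `J(f) ≠ 0`
  have hJ : (jacobianMatrix f).det ≠ 0 := det_jacobianMatrix_ne_zero_of_algebraicIndependent f hfi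
  -- Step 5: a point off the hypersurface `J(f) = 0` (`ℂ` is infinite)
  obtain ⟨γ, hγ⟩ : ∃ γ : σ → ℂ, eval γ (jacobianMatrix f).det ≠ 0 := by
    by_contra h
    push Not at h
    exact hJ (MvPolynomial.funext fun x => by rw [h x, map_zero])
  -- Step 6: the maximal minor of the gradient matrix on the rows `rows` is `J(f)(γ) ≠ 0`
  set G : Matrix (Fin T) σ ℂ := Matrix.of fun o j => eval γ (pderiv j (P o)) with hG
  refine ⟨γ, le_antisymm (Matrix.rank_le_card_width G) ?_⟩
  have hsub : G.submatrix rows id = (jacobianMatrix f).map (eval γ) := by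
    ext k j
    simp only [hG, Matrix.submatrix_apply, Matrix.of_apply, Matrix.map_apply, jacobianMatrix_apply,
      id, hfQ, hpd]
  have hdet : (G.submatrix rows id).det ≠ 0 := by
    rw [hsub, ← RingHom.mapMatrix_apply, ← RingHom.map_det]
    exact hγ
  exact Literature.LinearAlgebra.Matrix.card_le_rank_of_det_submatrix_ne_zero G rows id hdet

/-! ## The `gradMatrix` form: `stub_isolatedForcesRank` of line «initform» for forms -/

/-- **`IsolatedForcesRank` for HOMOGENEOUS families** (the form in which line «initform» uses it):
if `P_o ∈ ℂ[F_q : q ∈ n × n]` are forms and `{F | ∀ o, P_o(F) = P_o(0)} = {0}`, then the gradient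
matrix `(∂P_o/∂F_q)(γ)` has rank `n²` at some `γ`. -/
theorem isolatedForcesRank_of_isHomogeneous (n T : ℕ) (d : Fin T → ℕ)
    (P : Fin T → MvPolynomial (Fin n × Fin n) ℂ) (hP : ∀ o, (P o).IsHomogeneous (d o))
    (hiso : ∀ F₀ : Fin n × Fin n → ℂ, (∀ o, eval F₀ (P o) = eval 0 (P o)) → F₀ = 0) :
    ∃ γ : Fin n × Fin n → ℂ, (gradMatrix γ P).rank = n * n := by
  obtain ⟨γ, hγ⟩ := exists_jacobian_rank_eq_card_of_isHomogeneous P d hP hiso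
  refine ⟨γ, ?_⟩
  rw [show gradMatrix γ P = Matrix.of fun o j => eval γ (pderiv j (P o)) from rfl, hγ]
  simp [Fintype.card_prod, Fintype.card_fin]

end Summit.MatrixMultiplication.MatrixMultiplication.Theorems.GraphEquations

end
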